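import Summits.CriticalPhenomena.PercolationContinuityZ3.Theorems.PercNecklaceBackboneNoBackboneBirthGlue
import Literature.Probability.Percolation.CriticalContinuityProofs
import Literature.Probability.Percolation.BondTwoArmsBox
import Literature.Probability.Percolation.HalfSpaceStar
import HarnessLib

/-!
# Crux `NoBackbone` (stmt-CriticalPhenomena-5268), line `registered` — the lower window of the two-cluster engine

The finite-energy comparison between the Aizenman–Kesten–Newman TWO-CLUSTER (edge two-arms)
function and the cut-form TWO-ROUTE function of the line: for every `p ∈ [0,1]`, direction `i`
and scale `m ≥ 1`,

  `p · P_p(edgeTwoArms i m) ≤ P_p(T_m)`,   `T_m = {ω | ∀ e, ∃ y, ‖y‖∞ ≥ m ∧ 0 ↔ y in ω ∖ {e}}`.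

Proof (one-edge surgery, the mechanism of Aizenman–Kesten–Newman 1987 / Burton–Keane 1989): on
`edgeTwoArms i m` the edge `E = ⟨0, eᵢ⟩` is closed and the clusters of `0` and of `eᵢ` inside
`Λ_m` are distinct and both reach `∂ⁱⁿΛ_m`; OPENING `E` produces a configuration in which every
single-edge deletion leaves an open route from `0` to `∂ⁱⁿΛ_m` (`insert_mem_twoRoute_of_edgeTwoArms`:
a deleted edge inside the cluster of `0` is avoided by the route `0 — eᵢ ↝ ∂ⁱⁿΛ_m` through the other
cluster, any other deleted edge by the route inside the cluster of `0`).  The event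
`{ω | ω ∖ {E} ∈ edgeTwoArms i m}` is determined by the edges other than `E`, hence independent of
`{E open}` (probability `p`), which gives the inequality (`mul_real_edgeTwoArms_le_twoRoute`).

Consequence for the line: together with `noBackbone_of_twoClusterDomination`
(`…TwoClusterEngine.lean`) the two-cluster engine is SANDWICHED exactly like the half-space engine
(`mul_armH_sq_le_twoRoute` / `stub_surfaceDomination`): the easy direction `P(edgeTwoArms) ≤ P(T)/p`
is a theorem (so the two-cluster exponent is at least the two-route exponent, `x_A ≥ x_T`), and the
open content is the converse up to a loss `m^κ`, `κ < 1/2`.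

Sources: Aizenman–Kesten–Newman, Comm. Math. Phys. 111 (1987); Burton–Keane, Comm. Math. Phys. 121
(1989); Grimmett 1999 §8.2.
-/

noncomputable section

namespace Summit.CriticalPhenomena.PercolationContinuityZ3.Theorems.NoBackboneBirth

open MeasureTheory Filter Literature.Probability.Percolation Literature.Probability.LatticeModels
open scoped Topology

/-! ## Deterministic lemmas -/

/-- **Route transfer along a constrained cluster**: if every open `K`-step out of the
`K`-constrained `ω₁`-cluster of `x` is open in `ω₂`, then every vertex of that cluster is joined
to `x` by an `ω₂`-open path. [folklore] -/
theorem reachable_of_mem_openClusterIn_of_steps {V : Type*} {K : SimpleGraph V}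
    {ω₁ ω₂ : BondConfig V} {x y : V} (hy : y ∈ openClusterIn K ω₁ x)
    (hstep : ∀ a b : V, a ∈ openClusterIn K ω₁ x → K.Adj a b → s(a, b) ∈ ω₁ → s(a, b) ∈ ω₂) :
    (openGraph ω₂).Reachable x y := by
  rw [mem_openClusterIn_iff] at hy
  obtain ⟨q⟩ := hy
  suffices h : ∀ u : V, u ∈ openClusterIn K ω₁ x →
      ∀ q : (openGraph ω₁ ⊓ K).Walk u y, (openGraph ω₂).Reachable u y from
    h x (self_mem_openClusterIn _ _ _) q
  clear q
  intro u hu q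
  induction q with
  | nil => exact SimpleGraph.Reachable.refl _
  | @cons a b c hab q ih =>
    rw [SimpleGraph.inf_adj, openGraph_adj] at hab
    have hb : b ∈ openClusterIn K ω₁ x := mem_openClusterIn_of_adj hu hab.2 hab.1.1
    have hadj : (openGraph ω₂).Adj a b :=
      (openGraph_adj _ _ _).2 ⟨hstep a b hu hab.2 hab.1.1, hab.1.2⟩
    exact hadj.reachable.trans (ih hb)

/-- A vertex of the inner boundary of the box `Λ_m ⊆ ℤ³` has sup-norm at least `m`. [folklore] -/
theorem exists_le_abs_of_mem_innerBoundary_box {m : ℕ} {w : Site 3}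
    (hw : w ∈ innerBoundary (zdGraph 3) (box 3 m)) : ∃ j : Fin 3, (m : ℤ) ≤ |w j| := by
  rw [mem_innerBoundary_iff] at hw
  obtain ⟨hwbox, y, hy, hadj⟩ := hw
  rw [mem_box] at hwbox hy
  push Not at hy
  obtain ⟨k, hk⟩ := hy
  refine ⟨k, ?_⟩
  have hwk := hwbox k
  -- `y k` and `w k` differ by at most one
  have hdiff : y k = w k ∨ y k = w k + 1 ∨ w k = y k + 1 := by
    rw [zdGraph_adj_iff] at hadj
    obtain ⟨j, hj | hj⟩ := hadj
    · have hyk : y k = w k + (Pi.single j (1 : ℤ) : Site 3) k := by rw [hj]; rfl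
      by_cases hkj : k = j
      · subst hkj; rw [Pi.single_eq_same] at hyk; exact Or.inr (Or.inl hyk)
      · rw [Pi.single_eq_of_ne hkj, add_zero] at hyk; exact Or.inl hyk
    · have hwk' : w k = y k + (Pi.single j (1 : ℤ) : Site 3) k := by rw [hj]; rfl
      by_cases hkj : k = j
      · subst hkj; rw [Pi.single_eq_same] at hwk'; exact Or.inr (Or.inr hwk')
      · rw [Pi.single_eq_of_ne hkj, add_zero] at hwk'; exact Or.inl hwk'.symm
  rw [le_abs]
  by_cases h1 : -(m : ℤ) ≤ y k
  · have h2 := hk h1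
    omega
  · omega

/-- `0` and `eᵢ` are adjacent in `ℤ³`. [folklore] -/
theorem zdGraph_adj_zero_single (i : Fin 3) : (zdGraph 3).Adj (0 : Site 3) (Pi.single i 1) :=
  (zdGraph_adj_iff _ _).2 ⟨i, Or.inl (by rw [zero_add])⟩

/-- For `m ≥ 1`, `0` and `eᵢ` are adjacent in the step graph inside `Λ_m`. [folklore] -/
theorem withinGraph_box_adj_zero_single (i : Fin 3) {m : ℕ} (hm : 1 ≤ m) :
    (withinGraph (zdGraph 3) ↑(box 3 m)).Adj (0 : Site 3) (Pi.single i 1) := by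
  refine withinGraph_adj.2 ⟨zdGraph_adj_zero_single i, ?_, ?_⟩
  · rw [Finset.mem_coe, mem_box]
    intro j; simp
  · rw [Finset.mem_coe, mem_box]
    intro j
    by_cases hji : j = i
    · subst hji; rw [Pi.single_eq_same]; omega
    · rw [Pi.single_eq_of_ne hji]; omega

/-- **Opening the edge `⟨0, eᵢ⟩` of a two-cluster configuration gives a two-route configuration.**
If `ω ∖ {⟨0,eᵢ⟩} ∈ edgeTwoArms i m` and `⟨0,eᵢ⟩ ∈ ω`, then for every `e` the origin is still
joined in `ω ∖ {e}` to a site at sup-distance `≥ m`: if `e` is an open step joining two vertices of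
the cluster `C₀` of `0` (for `ω ∖ {⟨0,eᵢ⟩}`, inside `Λ_m`), use the edge `⟨0,eᵢ⟩` (it is not `e`,
as `eᵢ ∉ C₀`) and then the cluster of `eᵢ`, which is vertex-disjoint from `C₀`; otherwise the
cluster `C₀` itself survives the deletion of `e`. [folklore] -/
theorem insert_mem_twoRoute_of_edgeTwoArms {i : Fin 3} {m : ℕ} {ω : BondConfig (Site 3)}
    (hω : ω \ {s((0 : Site 3), Pi.single i 1)} ∈ AKN.edgeTwoArms i m)
    (hE : s((0 : Site 3), Pi.single i 1) ∈ ω) :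
    ω ∈ {ω : BondConfig (Site 3) | ∀ e : Sym2 (Site 3), ∃ y : Site 3,
      (∃ j : Fin 3, (m : ℤ) ≤ |y j|) ∧ ω \ {e} ∈ openConn (0 : Site 3) y} := by
  set E : Sym2 (Site 3) := s((0 : Site 3), Pi.single i 1) with hEdef
  set ω' : BondConfig (Site 3) := ω \ {E} with hω'
  set K : SimpleGraph (Site 3) := withinGraph (zdGraph 3) ↑(box 3 m) with hK
  obtain ⟨hnot, ⟨w₀, hw₀b, hw₀C⟩, ⟨w₁, hw₁b, hw₁C⟩⟩ := hω
  have hsub : ω' ⊆ ω := Set.sdiff_subset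
  intro e
  by_cases h : e ∈ ω' ∧ ∀ v ∈ e, v ∈ openClusterIn K ω' 0
  · -- route 2 : `0 — eᵢ ↝ w₁`
    obtain ⟨he₁, he₂⟩ := h
    have hEe : E ≠ e := by
      intro hEe
      apply hnot
      exact he₂ _ (by rw [← hEe, hEdef]; exact Sym2.mem_mk_right _ _)
    have hE' : E ∈ ω \ {e} := ⟨hE, fun h' => hEe h'⟩
    have hadj : (openGraph (ω \ {e})).Adj (0 : Site 3) (Pi.single i 1) :=
      (openGraph_adj _ _ _).2 ⟨hE', (zdGraph_adj_zero_single i).ne⟩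
    have hreach : (openGraph (ω \ {e})).Reachable (Pi.single i 1 : Site 3) w₁ := by
      refine reachable_of_mem_openClusterIn_of_steps hw₁C fun a b ha hab hab' => ⟨hsub hab', ?_⟩
      intro habe
      rw [Set.mem_singleton_iff] at habe
      -- `a ∈ e`, so `a ∈ C₀`; but `a ∈ C₁`, so `eᵢ ∈ C₀` — contradiction
      have haC₀ : a ∈ openClusterIn K ω' 0 := he₂ a (by rw [← habe]; exact Sym2.mem_mk_left _ _)
      apply hnot
      have h1 : openClusterIn K ω' a = openClusterIn K ω' (Pi.single i 1) := openClusterIn_eq_of_mem ha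
      have h0 : openClusterIn K ω' a = openClusterIn K ω' 0 := openClusterIn_eq_of_mem haC₀
      have : (Pi.single i 1 : Site 3) ∈ openClusterIn K ω' a := by
        rw [h1]; exact self_mem_openClusterIn _ _ _
      rwa [h0] at this
    exact ⟨w₁, exists_le_abs_of_mem_innerBoundary_box hw₁b, hadj.reachable.trans hreach⟩
  · -- route 1 : the cluster of `0` survives
    refine ⟨w₀, exists_le_abs_of_mem_innerBoundary_box hw₀b, ?_⟩
    refine reachable_of_mem_openClusterIn_of_steps hw₀C fun a b ha hab hab' => ⟨hsub hab', ?_⟩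
    intro habe
    rw [Set.mem_singleton_iff] at habe
    apply h
    refine ⟨habe ▸ hab', fun v hv => ?_⟩
    rw [← habe] at hv
    rcases Sym2.mem_iff.1 hv with rfl | rfl
    · exact ha
    · exact mem_openClusterIn_of_adj ha hab hab'

/-! ## The inequality -/

/-- **`p · P_p(edgeTwoArms i m) ≤ P_p(T_m)`** for every `p`, every direction `i` and every
`m ≥ 1`: the Aizenman–Kesten–Newman two-cluster function is at most `1/p` times the cut-form
two-route function (one-edge surgery + independence of the edge `⟨0,eᵢ⟩` from the event
`{ω ∖ {⟨0,eᵢ⟩} ∈ edgeTwoArms i m}`, which is determined by the other edges).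
[cite: AizenmanKestenNewmanCMP1987] -/
theorem mul_real_edgeTwoArms_le_twoRoute :
    ∀ (p : unitInterval) (i : Fin 3) (m : ℕ), 1 ≤ m → (p : ℝ) * (bondPercolation (zdGraph 3) p).real (AKN.edgeTwoArms i m) ≤ (bondPercolation (zdGraph 3) p).real {ω : BondConfig (Site 3) | ∀ e : Sym2 (Site 3), ∃ y : Site 3, (∃ j : Fin 3, (m : ℤ) ≤ |y j|) ∧ ω \ {e} ∈ openConn (0 : Site 3) y} := by
  intro p i m hm
  set μ := bondPercolation (zdGraph 3) p with hμ
  set E : Sym2 (Site 3) := s((0 : Site 3), Pi.single i 1) with hEdef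
  set B : Set (BondConfig (Site 3)) := (fun ω => ω \ {E}) ⁻¹' AKN.edgeTwoArms i m with hBdef
  set A : Set (BondConfig (Site 3)) := {ω | E ∈ ω} with hAdef
  -- the two-cluster event is contained in `B` (the edge `E` is closed on it)
  have hsubB : AKN.edgeTwoArms i m ⊆ B := by
    intro ω hω
    have hEω : E ∉ ω := fun hEω =>
      hω.1 (mem_openClusterIn_of_adj (self_mem_openClusterIn _ _ _)
        (withinGraph_box_adj_zero_single i hm) hEω)
    show ω \ {E} ∈ AKN.edgeTwoArms i m
    rwa [Set.sdiff_singleton_eq_self hEω]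
  -- `B ∩ A ⊆ T_m`
  have hBA : B ∩ A ⊆ {ω : BondConfig (Site 3) | ∀ e : Sym2 (Site 3),
      ∃ y : Site 3, (∃ j : Fin 3, (m : ℤ) ≤ |y j|) ∧ ω \ {e} ∈ openConn (0 : Site 3) y} :=
    fun ω hω => insert_mem_twoRoute_of_edgeTwoArms hω.1 hω.2
  -- independence
  have hBd : DeterminedBy B ({E}ᶜ : Set (Sym2 (Site 3))) := by
    rw [determinedBy_iff]
    intro ω₁ ω₂ h
    show ω₁ \ {E} ∈ AKN.edgeTwoArms i m ↔ ω₂ \ {E} ∈ AKN.edgeTwoArms i m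
    rw [Set.sdiff_eq, Set.sdiff_eq, h]
  have hAd : DeterminedBy A ({E} : Set (Sym2 (Site 3))) := BGN.determinedBy_mem_edge E
  have hBm : MeasurableSet B :=
    AKN.measurable_diff_singleton E (AKN.measurableSet_edgeTwoArms i m)
  have hAm : MeasurableSet A := measurableSet_mem _
  have hind : μ.real (B ∩ A) = μ.real B * μ.real A :=
    bondPercolation_real_inter_of_disjoint (zdGraph 3) p disjoint_compl_left hBd hAd hBm hAm
  have hPA : μ.real A = p :=
    bondPercolation_cylinder (zdGraph 3) p ((SimpleGraph.mem_edgeSet _).2 (zdGraph_adj_zero_single i))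
  have hp0 : (0 : ℝ) ≤ p := p.2.1
  calc (p : ℝ) * μ.real (AKN.edgeTwoArms i m) ≤ (p : ℝ) * μ.real B :=
        mul_le_mul_of_nonneg_left (measureReal_mono hsubB) hp0
    _ = μ.real (B ∩ A) := by rw [hind, hPA, mul_comm]
    _ ≤ _ := measureReal_mono hBA

/-- **The two-cluster exponent is at least the two-route exponent, in rate form**: any polynomial
bound `P_{p_c}(T_m) ≤ C m^{-x}` on the two-route function transfers to the two-cluster function,
`P_{p_c}(edgeTwoArms i m) ≤ (C/p_c) m^{-x}` (`m ≥ 1`). [folklore] -/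
theorem real_edgeTwoArms_le_of_twoRoute_le {C x : ℝ} (i : Fin 3)
    (h : ∀ m : ℕ, 1 ≤ m → (bondPercolation (zdGraph 3) (criticalProbI 3)).real
      {ω : BondConfig (Site 3) | ∀ e : Sym2 (Site 3), ∃ y : Site 3, (∃ j : Fin 3, (m : ℤ) ≤ |y j|) ∧
        ω \ {e} ∈ openConn (0 : Site 3) y} ≤ C * (m : ℝ) ^ (-x)) :
    ∀ m : ℕ, 1 ≤ m → (bondPercolation (zdGraph 3) (criticalProbI 3)).real (AKN.edgeTwoArms i m) ≤
      C / (criticalProbI 3 : ℝ) * (m : ℝ) ^ (-x) := by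
  intro m hm
  have hp0 : 0 < (criticalProbI 3 : ℝ) := by
    rw [coe_criticalProbI]; exact criticalProb_zd_pos 3 (by norm_num)
  have h1 := (mul_real_edgeTwoArms_le_twoRoute (criticalProbI 3) i m hm).trans (h m hm)
  rw [div_mul_eq_mul_div, le_div_iff₀ hp0, mul_comm]
  exact h1

end Summit.CriticalPhenomena.PercolationContinuityZ3.Theorems.NoBackboneBirth

end
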